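import Summits.QuantumFields.QCD.Theses.PauliWegnerSea
import Summits.QuantumFields.QCD.Theorems.PauliWegnerSeaTiltedFlatness
import Summits.QuantumFields.QCD.Theorems.PauliWegnerSeaFMClosureUnquenchedFibreBandLawC1Aux1
import Summits.QuantumFields.QCD.Theorems.PauliWegnerSeaFMClosureUnquenchedFibreBandLawC1Aux2
import Literature.MeasureTheory.Integral.TiltedAnticoncentration

/-!
# Stub `stub_fibreBandLaw` of crux `PauliWegnerSea.FMClosureUnquenched` (stmt-QuantumFields-11512)

Line `von-mises-circles`, stub 1b (registered text verbatim), seat c1.  **The fibre band law**: for all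
`n, d` there are `s₀, C, p > 0` such that on every torus, for every link set `R` with `≤ n` links, every
outside field, every `β ∈ ℝ` and all fibre polynomials `P ≢ 0` (the tilt) and `Q` of degree `≤ d`, under
`ν ∝ e^{-β S_W∘refit} ‖P∘refit‖ · Haar^{⊗E}`: (AE) `Q∘refit ≢ 0 ⇒ ≠ 0` a.e.; (Flat)
`‖Q(refit W₀)‖ ≤ C(1+|β|)^p E_ν‖Q∘refit‖`; (Neg) `E_ν‖Q∘refit‖^{-s} ≤ C(1+|β|)^p (sup‖Q∘refit‖)^{-s}`, `s ≤ s₀`.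

Proof (circle-transport SHORTCUT; the registered 1-D circle-law hypothesis is not used): the landed stubs
of crux K3 (namespace `CircleTransport`) at the diagonal circle (`exists_diagCircle`, `stub_eulerWord`) give
HAAR SMALL BALLS for every continuous `F ≥ 0` of `≤ n` listed links whose square is band-limited of degree
`4d` along the moves `W[e ↦ A T(t) B]` (`stub_haarSmallBalls` ∘ `stub_torusSmallBalls` ∘ `stub_circleEngine`;
band limits by `c1_fibreBandLaw_normSqTrigPoly`, the orbit hypothesis being read at the base point `W[e ↦ 1]`
with `V = A`, `B' = AB`) and the DENSITY BOUND `e^{-βS∘refit} ≤ C_D(1+|β|)^{p_D} ∫ e^{-βS∘refit}`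
(`stub_circleUntilt` + `c1_fibreBandLaw_actionLipschitz`, all volumes; `β < 0` via `S ↦ -S`); the abstract
core `c1_fibreBandLaw_core` concludes with `s₀ = c/2`, `C = max(Cf C_D'^{1/c}, Cn C_D'^{1+1/c})`,
`p = max(p_D,0)(1+1/c)`, `C_D' = max(C_D,1)`.
-/

noncomputable section

namespace Summit.QuantumFields.QCD.Theorems.VonMisesCirclesC1

open scoped BigOperators
open MeasureTheory Filter
open Literature.MathematicalPhysics.QuantumFieldTheory Literature.MathematicalPhysics.QuantumLattice
  Literature.Probability.LatticeModels

/-- The constant `1` is a trigonometric polynomial of every degree. -/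
private theorem trigPoly_one (d : ℕ) : ∃ c : ℤ → ℂ, ∀ s : ℝ,
    (1 : ℂ) = ∑ k ∈ Finset.Icc (-(d : ℤ)) d, c k * Complex.exp ((k : ℂ) * (s : ℂ) * Complex.I) := by
  refine ⟨fun k => if k = 0 then 1 else 0, fun s => ?_⟩
  rw [Finset.sum_eq_single (0 : ℤ)]
  · simp
  · intro k _ hk
    simp [hk]
  · intro h
    exact absurd (by simp) h

/-- The fibre band law in the skeleton's `let` form (conclusion of stub 1b verbatim), proved outright. -/
private theorem fibreBandLaw_let : ∀ n d : ℕ, ∃ s₀ C p : ℝ, 0 < s₀ ∧ 0 < C ∧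
      ∀ (N : ℕ) [NeZero N] (R : Finset (Edge 4 N)), R.card ≤ n →
      ∀ (U : GaugeConfig 4 N (Matrix.specialUnitaryGroup (Fin 3) ℂ)) (β : ℝ)
        (P Q : GaugeConfig 4 N (Matrix.specialUnitaryGroup (Fin 3) ℂ) → ℂ),
      (Continuous P ∧ ∀ (W : GaugeConfig 4 N (Matrix.specialUnitaryGroup (Fin 3) ℂ)) (e : Edge 4 N)
          (V B : Matrix.specialUnitaryGroup (Fin 3) ℂ) (T : ℝ → Matrix.specialUnitaryGroup (Fin 3) ℂ),
        (∀ θ : ℝ, ((T θ : Matrix.specialUnitaryGroup (Fin 3) ℂ) : Matrix (Fin 3) (Fin 3) ℂ) =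
          Matrix.diagonal ![Complex.exp (θ * Complex.I), Complex.exp (-(θ * Complex.I)), 1]) →
        ∃ c : ℤ → ℂ, ∀ θ : ℝ, P (Function.update W e (W e * (V * T θ * V⁻¹) * B)) =
          ∑ k ∈ Finset.Icc (-(d : ℤ)) d, c k * Complex.exp ((k : ℂ) * (θ : ℂ) * Complex.I)) →
      (Continuous Q ∧ ∀ (W : GaugeConfig 4 N (Matrix.specialUnitaryGroup (Fin 3) ℂ)) (e : Edge 4 N)
          (V B : Matrix.specialUnitaryGroup (Fin 3) ℂ) (T : ℝ → Matrix.specialUnitaryGroup (Fin 3) ℂ),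
        (∀ θ : ℝ, ((T θ : Matrix.specialUnitaryGroup (Fin 3) ℂ) : Matrix (Fin 3) (Fin 3) ℂ) =
          Matrix.diagonal ![Complex.exp (θ * Complex.I), Complex.exp (-(θ * Complex.I)), 1]) →
        ∃ c : ℤ → ℂ, ∀ θ : ℝ, Q (Function.update W e (W e * (V * T θ * V⁻¹) * B)) =
          ∑ k ∈ Finset.Icc (-(d : ℤ)) d, c k * Complex.exp ((k : ℂ) * (θ : ℂ) * Complex.I)) →
      let refit : GaugeConfig 4 N (Matrix.specialUnitaryGroup (Fin 3) ℂ) →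
          GaugeConfig 4 N (Matrix.specialUnitaryGroup (Fin 3) ℂ) := fun W e => if e ∈ R then W e else U e
      let wt : GaugeConfig 4 N (Matrix.specialUnitaryGroup (Fin 3) ℂ) → ℝ := fun W =>
        Real.exp (-(β * wilsonAction (fundamentalRep (Fin 3)) (refit W))) * ‖P (refit W)‖
      let haar : MeasureTheory.Measure (GaugeConfig 4 N (Matrix.specialUnitaryGroup (Fin 3) ℂ)) :=
        MeasureTheory.Measure.pi fun _ => haarProbability (Matrix.specialUnitaryGroup (Fin 3) ℂ)
      let Z : ℝ := ∫ W, wt W ∂haar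
      (∃ W, P (refit W) ≠ 0) →
        ((∃ W, Q (refit W) ≠ 0) → ∀ᵐ W ∂haar, Q (refit W) ≠ 0) ∧
        (∀ W₀ : GaugeConfig 4 N (Matrix.specialUnitaryGroup (Fin 3) ℂ),
          ‖Q (refit W₀)‖ ≤ C * (1 + |β|) ^ p * ((∫ W, ‖Q (refit W)‖ * wt W ∂haar) / Z)) ∧
        (∀ s : ℝ, 0 < s → s ≤ s₀ →
          MeasureTheory.Integrable (fun W => ‖Q (refit W)‖ ^ (-s) * wt W) haar ∧
          (∫ W, ‖Q (refit W)‖ ^ (-s) * wt W ∂haar) / Z ≤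
            C * (1 + |β|) ^ p * (⨆ W : GaugeConfig 4 N (Matrix.specialUnitaryGroup (Fin 3) ℂ), ‖Q (refit W)‖) ^ (-s)) := by
  intro n d
  -- the landed circle-transport machinery of crux K3 at the diagonal circle
  obtain ⟨T, hT⟩ := CircleTransport.exists_diagCircle
  have hW := CircleTransport.stub_eulerWord T hT
  obtain ⟨C_R, c, hCR, hc, hSB⟩ := CircleTransport.stub_haarSmallBalls T hT hW
    (CircleTransport.stub_torusSmallBalls CircleTransport.stub_circleEngine.1
      CircleTransport.stub_circleEngine.2) (4 * d) n
  obtain ⟨Kl, -, hKl⟩ := c1_fibreBandLaw_actionLipschitz T hT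
  obtain ⟨C_D, p_D, hCD, hD⟩ := CircleTransport.stub_circleUntilt T hT hW n Kl
  obtain ⟨Cf, Cn, hCf, hCn, hcore⟩ := c1_fibreBandLaw_core C_R c hCR.le hc
  -- constants
  set p' : ℝ := max p_D 0 with hp'
  set CD' : ℝ := max C_D 1 with hCD'
  set Cbig : ℝ := max (Cf * CD' ^ (1 / c)) (Cn * CD' ^ (1 + 1 / c)) with hCbig
  set pexp : ℝ := p' * (1 + 1 / c) with hpexp
  have hCD'1 : 1 ≤ CD' := le_max_right _ _
  have hp'0 : 0 ≤ p' := le_max_right _ _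
  refine ⟨c / 2, Cbig, pexp, by linarith, lt_max_of_lt_left (by positivity), ?_⟩
  intro N _ R hR U β P Q hP hQ refit wt haar Z hP0
  have hone := trigPoly_one d
  -- instances on the fibre `SU(3)^E`
  haveI : IsProbabilityMeasure haar := by
    show IsProbabilityMeasure
      (Measure.pi fun _ : Edge 4 N => haarProbability (Matrix.specialUnitaryGroup (Fin 3) ℂ))
    infer_instance
  haveI : (haarProbability (Matrix.specialUnitaryGroup (Fin 3) ℂ)).IsOpenPosMeasure := by
    unfold haarProbability; infer_instance
  haveI : haar.IsOpenPosMeasure := by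
    show (Measure.pi fun _ : Edge 4 N =>
      haarProbability (Matrix.specialUnitaryGroup (Fin 3) ℂ)).IsOpenPosMeasure
    infer_instance
  -- `refit`: continuity, dependence on the listed links only, commutation with `update`
  have hrefc : Continuous refit := by
    refine continuous_pi fun e => ?_
    by_cases h : e ∈ R
    · simp only [refit, if_pos h]; exact continuous_apply e
    · simp only [refit, if_neg h]; exact continuous_const
  have hdepR : ∀ W W' : GaugeConfig 4 N (Matrix.specialUnitaryGroup (Fin 3) ℂ),
      (∀ i : ↥R, W (i : Edge 4 N) = W' i) → refit W = refit W' := by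
    intro W W' h; funext e; by_cases he : e ∈ R
    · show (if e ∈ R then W e else U e) = (if e ∈ R then W' e else U e)
      rw [if_pos he, if_pos he]; exact h ⟨e, he⟩
    · show (if e ∈ R then W e else U e) = (if e ∈ R then W' e else U e); rw [if_neg he, if_neg he]
  have hupd : ∀ e ∈ R, ∀ (W : GaugeConfig 4 N (Matrix.specialUnitaryGroup (Fin 3) ℂ))
      (g : Matrix.specialUnitaryGroup (Fin 3) ℂ),
      refit (Function.update W e g) = Function.update (refit W) e g := by
    intro e he W g; funext e'; by_cases h : e' = e
    · rw [h, Function.update_self]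
      show (if e ∈ R then Function.update W e g e else U e) = g
      rw [if_pos he, Function.update_self]
    · rw [Function.update_of_ne h]
      show (if e' ∈ R then Function.update W e g e' else U e') = refit W e'
      rw [Function.update_of_ne h]
  -- the orbit hypothesis along the two-sided moves `A T(θ) B`
  have horb : ∀ F : GaugeConfig 4 N (Matrix.specialUnitaryGroup (Fin 3) ℂ) → ℂ,
      (∀ (W : GaugeConfig 4 N (Matrix.specialUnitaryGroup (Fin 3) ℂ)) (e : Edge 4 N)
        (V B : Matrix.specialUnitaryGroup (Fin 3) ℂ) (T : ℝ → Matrix.specialUnitaryGroup (Fin 3) ℂ),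
        (∀ θ : ℝ, ((T θ : Matrix.specialUnitaryGroup (Fin 3) ℂ) : Matrix (Fin 3) (Fin 3) ℂ) =
          Matrix.diagonal ![Complex.exp (θ * Complex.I), Complex.exp (-(θ * Complex.I)), 1]) →
        ∃ c : ℤ → ℂ, ∀ θ : ℝ, F (Function.update W e (W e * (V * T θ * V⁻¹) * B)) =
          ∑ k ∈ Finset.Icc (-(d : ℤ)) d, c k * Complex.exp ((k : ℂ) * (θ : ℂ) * Complex.I)) →
      ∀ (X : GaugeConfig 4 N (Matrix.specialUnitaryGroup (Fin 3) ℂ)) (e : Edge 4 N)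
        (A B : Matrix.specialUnitaryGroup (Fin 3) ℂ), ∃ c : ℤ → ℂ, ∀ θ : ℝ,
        F (Function.update X e (A * T θ * B)) =
          ∑ k ∈ Finset.Icc (-(d : ℤ)) d, c k * Complex.exp ((k : ℂ) * (θ : ℂ) * Complex.I) := by
    intro F hF X e A B
    obtain ⟨cF, hcF⟩ := hF (Function.update X e 1) e A (A * B) T hT
    refine ⟨cF, fun θ => ?_⟩
    rw [← hcF θ, Function.update_self, Function.update_idem]
    congr 2
    group
  have horbQ := horb Q hQ.2
  have horbP := horb P hP.2
  -- the three fibre amplitudes and the weight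
  set FQ : GaugeConfig 4 N (Matrix.specialUnitaryGroup (Fin 3) ℂ) → ℝ := fun W => ‖Q (refit W)‖
  set FP : GaugeConfig 4 N (Matrix.specialUnitaryGroup (Fin 3) ℂ) → ℝ := fun W => ‖P (refit W)‖
  set S : GaugeConfig 4 N (Matrix.specialUnitaryGroup (Fin 3) ℂ) → ℝ := fun W =>
    wilsonAction (fundamentalRep (Fin 3)) (refit W)
  set w : GaugeConfig 4 N (Matrix.specialUnitaryGroup (Fin 3) ℂ) → ℝ := fun W => Real.exp (-(β * S W))
  have hFQc : Continuous FQ := (hQ.1.comp hrefc).norm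
  have hFPc : Continuous FP := (hP.1.comp hrefc).norm
  have hSc : Continuous S :=
    (TiltedFlatnessNegative.continuous_wilsonAction (fundamentalRep (Fin 3))
      (continuous_fundamentalRep (Fin 3))).comp hrefc
  have hwc : Continuous w := Real.continuous_exp.comp ((continuous_const.mul hSc).neg)
  have hFQ0 : ∀ W, 0 ≤ FQ W := fun W => norm_nonneg _
  have hFP0 : ∀ W, 0 ≤ FP W := fun W => norm_nonneg _
  have hw0 : ∀ W, 0 < w W := fun W => Real.exp_pos _
  have hFQdep : ∀ W W' : GaugeConfig 4 N (Matrix.specialUnitaryGroup (Fin 3) ℂ),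
      (∀ i : ↥R, W (i : Edge 4 N) = W' i) → FQ W = FQ W' := fun W W' h => by
    show ‖Q (refit W)‖ = ‖Q (refit W')‖; rw [hdepR W W' h]
  have hFPdep : ∀ W W' : GaugeConfig 4 N (Matrix.specialUnitaryGroup (Fin 3) ℂ),
      (∀ i : ↥R, W (i : Edge 4 N) = W' i) → FP W = FP W' := fun W W' h => by
    show ‖P (refit W)‖ = ‖P (refit W')‖; rw [hdepR W W' h]
  have hSdep : ∀ W W' : GaugeConfig 4 N (Matrix.specialUnitaryGroup (Fin 3) ℂ),
      (∀ i : ↥R, W (i : Edge 4 N) = W' i) → S W = S W' := fun W W' h => by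
    show wilsonAction _ (refit W) = wilsonAction _ (refit W'); rw [hdepR W W' h]
  -- band limits of the squares along the moves at listed links
  have hband1 : ∀ F : GaugeConfig 4 N (Matrix.specialUnitaryGroup (Fin 3) ℂ) → ℂ,
      (∀ (X : GaugeConfig 4 N (Matrix.specialUnitaryGroup (Fin 3) ℂ)) (e : Edge 4 N)
        (A B : Matrix.specialUnitaryGroup (Fin 3) ℂ), ∃ c : ℤ → ℂ, ∀ θ : ℝ,
        F (Function.update X e (A * T θ * B)) =
          ∑ k ∈ Finset.Icc (-(d : ℤ)) d, c k * Complex.exp ((k : ℂ) * (θ : ℂ) * Complex.I)) →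
      ∀ (W : GaugeConfig 4 N (Matrix.specialUnitaryGroup (Fin 3) ℂ)) (i : ↥R)
        (A B : Matrix.specialUnitaryGroup (Fin 3) ℂ), ∃ a : ℤ → ℂ, ∀ t : ℝ,
        ((‖F (refit (Function.update W i (A * T t * B)))‖ ^ 2 : ℝ) : ℂ) =
          ∑ k ∈ Finset.Icc (-((4 * d : ℕ) : ℤ)) ((4 * d : ℕ) : ℤ),
            a k * Complex.exp ((k : ℂ) * (t : ℂ) * Complex.I) := by
    intro F hF W i A B
    obtain ⟨a, ha⟩ := c1_fibreBandLaw_normSqTrigPoly (D := 4 * d) (by omega) (hF (refit W) i A B) hone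
    exact ⟨a, fun t => by rw [← ha t, hupd i i.2, norm_one, mul_one]⟩
  have hbandQP : ∀ (W : GaugeConfig 4 N (Matrix.specialUnitaryGroup (Fin 3) ℂ)) (i : ↥R)
      (A B : Matrix.specialUnitaryGroup (Fin 3) ℂ), ∃ a : ℤ → ℂ, ∀ t : ℝ,
      (((FQ (Function.update W i (A * T t * B)) * FP (Function.update W i (A * T t * B))) ^ 2 : ℝ) : ℂ) =
        ∑ k ∈ Finset.Icc (-((4 * d : ℕ) : ℤ)) ((4 * d : ℕ) : ℤ),
          a k * Complex.exp ((k : ℂ) * (t : ℂ) * Complex.I) := by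
    intro W i A B
    obtain ⟨a, ha⟩ := c1_fibreBandLaw_normSqTrigPoly (D := 4 * d) (by omega)
      (horbQ (refit W) i A B) (horbP (refit W) i A B)
    refine ⟨a, fun t => ?_⟩
    rw [← ha t]
    show ((((‖Q (refit (Function.update W i (A * T t * B)))‖) *
      ‖P (refit (Function.update W i (A * T t * B)))‖) ^ 2 : ℝ) : ℂ) = _
    rw [hupd i i.2]
  -- Haar small balls for the three amplitudes
  have hcard : Fintype.card ↥R ≤ n := by rw [Fintype.card_coe]; exact hR
  have hRQ := hSB (Edge 4 N) ↥R (fun i => (i : Edge 4 N)) hcard FQ hFQc hFQ0 hFQdep (hband1 Q horbQ)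
  have hRP := hSB (Edge 4 N) ↥R (fun i => (i : Edge 4 N)) hcard FP hFPc hFP0 hFPdep (hband1 P horbP)
  have hRQP := hSB (Edge 4 N) ↥R (fun i => (i : Edge 4 N)) hcard (fun W => FQ W * FP W)
    (hFQc.mul hFPc) (fun W => mul_nonneg (hFQ0 W) (hFP0 W))
    (fun W W' h => by rw [hFQdep W W' h, hFPdep W W' h]) hbandQP
  -- the density bound (both signs of `β`)
  have hSlip : ∀ (W : GaugeConfig 4 N (Matrix.specialUnitaryGroup (Fin 3) ℂ)) (i : ↥R)
      (A B : Matrix.specialUnitaryGroup (Fin 3) ℂ) (s s' : ℝ),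
      |S (Function.update W i (A * T s * B)) - S (Function.update W i (A * T s' * B))| ≤
        Kl * |s - s'| := by
    intro W i A B s s'
    show |wilsonAction _ (refit (Function.update W i (A * T s * B))) -
      wilsonAction _ (refit (Function.update W i (A * T s' * B)))| ≤ _
    rw [hupd i i.2, hupd i i.2]
    exact hKl N (refit W) i A B s s'
  have h1β : (1 : ℝ) ≤ 1 + |β| := by have := abs_nonneg β; linarith
  set K : ℝ := CD' * (1 + |β|) ^ p' with hK
  have hK1 : 1 ≤ K := one_le_mul_of_one_le_of_one_le hCD'1 (Real.one_le_rpow h1β hp'0)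
  have hdens0 : ∀ W, w W / (∫ W', w W' ∂haar) ≤ C_D * (1 + |β|) ^ p_D := by
    intro W
    rcases le_or_gt 0 β with hβ | hβ
    · rw [abs_of_nonneg hβ]
      exact hD (Edge 4 N) ↥R (fun i => (i : Edge 4 N)) hcard S hSc hSdep hSlip β hβ W
    · have hSlip' : ∀ (W : GaugeConfig 4 N (Matrix.specialUnitaryGroup (Fin 3) ℂ)) (i : ↥R)
          (A B : Matrix.specialUnitaryGroup (Fin 3) ℂ) (s s' : ℝ),
          |-S (Function.update W i (A * T s * B)) - -S (Function.update W i (A * T s' * B))| ≤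
            Kl * |s - s'| := by
        intro W i A B s s'
        rw [← abs_neg, show -(-S (Function.update W i (A * T s * B)) -
          -S (Function.update W i (A * T s' * B))) = S (Function.update W i (A * T s * B)) -
          S (Function.update W i (A * T s' * B)) by ring]
        exact hSlip W i A B s s'
      have h := hD (Edge 4 N) ↥R (fun i => (i : Edge 4 N)) hcard (fun W => -S W) hSc.neg
        (fun W W' h => by rw [hSdep W W' h]) hSlip' (-β) (by linarith) W
      rw [abs_of_neg hβ]
      simpa only [neg_mul_neg] using h
  have hwi : Integrable w haar := TiltedFlatnessNegative.integrable_of_continuous hwc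
  have hZw : 0 < ∫ W', w W' ∂haar := integral_exp_pos hwi
  have hCDK : C_D * (1 + |β|) ^ p_D ≤ K :=
    mul_le_mul (le_max_left _ _) (Real.rpow_le_rpow_of_exponent_le h1β (le_max_left _ _))
      (Real.rpow_nonneg (by linarith) _) (by linarith)
  have hdens : ∀ W, w W ≤ K * ∫ W', w W' ∂haar := fun W => by
    have h1 : w W / (∫ W', w W' ∂haar) ≤ K := (hdens0 W).trans hCDK; rwa [div_le_iff₀ hZw] at h1
  -- the abstract core
  have hPex : ∃ W, FP W ≠ 0 := by
    obtain ⟨W, hW⟩ := hP0; exact ⟨W, fun h => hW (norm_eq_zero.1 h)⟩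
  obtain ⟨hAE, hFlat, hNeg⟩ := hcore (GaugeConfig 4 N (Matrix.specialUnitaryGroup (Fin 3) ℂ)) haar
    FQ FP w hFQc hFPc hwc hFQ0 hFP0 hw0 K hK1 hdens hRQ hRP hRQP hPex
  -- constants: `Cf K^{1/c}, Cn K^{1+1/c} ≤ Cbig (1+|β|)^pexp`
  have hKc : K ^ (1 / c) ≤ CD' ^ (1 / c) * (1 + |β|) ^ pexp := by
    rw [hK, Real.mul_rpow (by linarith) (by positivity), ← Real.rpow_mul (by positivity)]
    refine mul_le_mul_of_nonneg_left (Real.rpow_le_rpow_of_exponent_le h1β ?_)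
      (Real.rpow_nonneg (by linarith) _)
    rw [hpexp, mul_add, mul_one]
    have : 0 ≤ p' := hp'0
    nlinarith [one_div_pos.2 hc]
  have hKc' : K ^ (1 + 1 / c) = CD' ^ (1 + 1 / c) * (1 + |β|) ^ pexp := by
    rw [hK, Real.mul_rpow (by linarith) (by positivity), ← Real.rpow_mul (by positivity)]
  have hCflat : Cf * K ^ (1 / c) ≤ Cbig * (1 + |β|) ^ pexp :=
    calc Cf * K ^ (1 / c) ≤ Cf * (CD' ^ (1 / c) * (1 + |β|) ^ pexp) :=
          mul_le_mul_of_nonneg_left hKc hCf.le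
      _ = Cf * CD' ^ (1 / c) * (1 + |β|) ^ pexp := by ring
      _ ≤ Cbig * (1 + |β|) ^ pexp :=
          mul_le_mul_of_nonneg_right (le_max_left _ _) (Real.rpow_nonneg (by linarith) _)
  have hCneg : Cn * K ^ (1 + 1 / c) ≤ Cbig * (1 + |β|) ^ pexp := by
    rw [hKc', ← mul_assoc]
    exact mul_le_mul_of_nonneg_right (le_max_right _ _) (Real.rpow_nonneg (by linarith) _)
  have hwt0 : ∀ W, 0 ≤ wt W := fun W => mul_nonneg (Real.exp_pos _).le (norm_nonneg _)
  have hZ0 : 0 ≤ Z := integral_nonneg hwt0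
  refine ⟨fun hex => ?_, fun W₀ => ?_, fun s hs hsc => ?_⟩
  · -- (AE)
    obtain ⟨W, hW⟩ := hex
    exact (hAE ⟨W, fun h => hW (norm_eq_zero.1 h)⟩).mono fun W h h' =>
      h (by show ‖Q (refit W)‖ = 0; rw [h', norm_zero])
  · -- (Flat)
    have hratio : 0 ≤ (∫ W, ‖Q (refit W)‖ * wt W ∂haar) / Z :=
      div_nonneg (integral_nonneg fun W => mul_nonneg (norm_nonneg _) (hwt0 W)) hZ0
    calc ‖Q (refit W₀)‖ = FQ W₀ := rfl
      _ ≤ Cf * K ^ (1 / c) * ((∫ W, ‖Q (refit W)‖ * wt W ∂haar) / Z) := hFlat W₀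
      _ ≤ Cbig * (1 + |β|) ^ pexp * ((∫ W, ‖Q (refit W)‖ * wt W ∂haar) / Z) :=
          mul_le_mul_of_nonneg_right hCflat hratio
  · -- (Neg)
    obtain ⟨hI, hle⟩ := hNeg s hs hsc
    refine ⟨hI, ?_⟩
    have hsup0 : 0 ≤ (⨆ W : GaugeConfig 4 N (Matrix.specialUnitaryGroup (Fin 3) ℂ),
        ‖Q (refit W)‖) ^ (-s) := Real.rpow_nonneg (Real.iSup_nonneg fun W => norm_nonneg _) _
    calc (∫ W, ‖Q (refit W)‖ ^ (-s) * wt W ∂haar) / Z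
        ≤ Cn * K ^ (1 + 1 / c) *
            (⨆ W : GaugeConfig 4 N (Matrix.specialUnitaryGroup (Fin 3) ℂ), ‖Q (refit W)‖) ^ (-s) := hle
      _ ≤ Cbig * (1 + |β|) ^ pexp *
            (⨆ W : GaugeConfig 4 N (Matrix.specialUnitaryGroup (Fin 3) ℂ), ‖Q (refit W)‖) ^ (-s) :=
          mul_le_mul_of_nonneg_right hCneg hsup0

/-- **The fibre band law, outright** (registered sub-goal `c1_fibreBandLaw` = `FibreBandLaw` of the
line's skeleton with its four `let`s turned into universally quantified names with defining equations;
no circle-law hypothesis): (AE), (Flat) and (Neg) for all fibre polynomials — see the module docstring. -/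
theorem c1_fibreBandLaw : ∀ n d : ℕ, ∃ s₀ C p : ℝ, 0 < s₀ ∧ 0 < C ∧
      ∀ (N : ℕ) [NeZero N] (R : Finset (Edge 4 N)), R.card ≤ n →
      ∀ (U : GaugeConfig 4 N (Matrix.specialUnitaryGroup (Fin 3) ℂ)) (β : ℝ)
        (P Q : GaugeConfig 4 N (Matrix.specialUnitaryGroup (Fin 3) ℂ) → ℂ),
      (Continuous P ∧ ∀ (W : GaugeConfig 4 N (Matrix.specialUnitaryGroup (Fin 3) ℂ)) (e : Edge 4 N)
          (V B : Matrix.specialUnitaryGroup (Fin 3) ℂ) (T : ℝ → Matrix.specialUnitaryGroup (Fin 3) ℂ),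
        (∀ θ : ℝ, ((T θ : Matrix.specialUnitaryGroup (Fin 3) ℂ) : Matrix (Fin 3) (Fin 3) ℂ) =
          Matrix.diagonal ![Complex.exp (θ * Complex.I), Complex.exp (-(θ * Complex.I)), 1]) →
        ∃ c : ℤ → ℂ, ∀ θ : ℝ, P (Function.update W e (W e * (V * T θ * V⁻¹) * B)) =
          ∑ k ∈ Finset.Icc (-(d : ℤ)) d, c k * Complex.exp ((k : ℂ) * (θ : ℂ) * Complex.I)) →
      (Continuous Q ∧ ∀ (W : GaugeConfig 4 N (Matrix.specialUnitaryGroup (Fin 3) ℂ)) (e : Edge 4 N)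
          (V B : Matrix.specialUnitaryGroup (Fin 3) ℂ) (T : ℝ → Matrix.specialUnitaryGroup (Fin 3) ℂ),
        (∀ θ : ℝ, ((T θ : Matrix.specialUnitaryGroup (Fin 3) ℂ) : Matrix (Fin 3) (Fin 3) ℂ) =
          Matrix.diagonal ![Complex.exp (θ * Complex.I), Complex.exp (-(θ * Complex.I)), 1]) →
        ∃ c : ℤ → ℂ, ∀ θ : ℝ, Q (Function.update W e (W e * (V * T θ * V⁻¹) * B)) =
          ∑ k ∈ Finset.Icc (-(d : ℤ)) d, c k * Complex.exp ((k : ℂ) * (θ : ℂ) * Complex.I)) →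
      ∀ (refit : GaugeConfig 4 N (Matrix.specialUnitaryGroup (Fin 3) ℂ) →
          GaugeConfig 4 N (Matrix.specialUnitaryGroup (Fin 3) ℂ)),
        (refit = fun W e => if e ∈ R then W e else U e) →
      ∀ (wt : GaugeConfig 4 N (Matrix.specialUnitaryGroup (Fin 3) ℂ) → ℝ),
        (wt = fun W => Real.exp (-(β * wilsonAction (fundamentalRep (Fin 3)) (refit W))) * ‖P (refit W)‖) →
      ∀ (haar : MeasureTheory.Measure (GaugeConfig 4 N (Matrix.specialUnitaryGroup (Fin 3) ℂ))),
        (haar = MeasureTheory.Measure.pi fun _ => haarProbability (Matrix.specialUnitaryGroup (Fin 3) ℂ)) →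
      ∀ (Z : ℝ), (Z = ∫ W, wt W ∂haar) →
      (∃ W, P (refit W) ≠ 0) →
        ((∃ W, Q (refit W) ≠ 0) → ∀ᵐ W ∂haar, Q (refit W) ≠ 0) ∧
        (∀ W₀ : GaugeConfig 4 N (Matrix.specialUnitaryGroup (Fin 3) ℂ),
          ‖Q (refit W₀)‖ ≤ C * (1 + |β|) ^ p * ((∫ W, ‖Q (refit W)‖ * wt W ∂haar) / Z)) ∧
        (∀ s : ℝ, 0 < s → s ≤ s₀ →
          MeasureTheory.Integrable (fun W => ‖Q (refit W)‖ ^ (-s) * wt W) haar ∧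
          (∫ W, ‖Q (refit W)‖ ^ (-s) * wt W ∂haar) / Z ≤
            C * (1 + |β|) ^ p * (⨆ W : GaugeConfig 4 N (Matrix.specialUnitaryGroup (Fin 3) ℂ), ‖Q (refit W)‖) ^ (-s)) := by
  intro n d
  obtain ⟨s₀, C, p, h0, h1, h⟩ := fibreBandLaw_let n d
  refine ⟨s₀, C, p, h0, h1, ?_⟩
  intro N _ R hR U β P Q hP hQ refit hrefit wt hwt haar hhaar Z hZ
  subst hrefit hwt hhaar hZ
  exact h N R hR U β P Q hP hQ

/-- **Stub 1b of line `von-mises-circles`: the fibre band law** (registered text verbatim; the 1-D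
circle-law hypothesis is carried but not used: the conclusion is `fibreBandLaw_let`). -/
theorem stub_fibreBandLaw :
    (∀ d dJ dh : ℕ,
      ∃ s₀ C p : ℝ, 0 < s₀ ∧ 0 < C ∧ ∀ (κ : ℝ) (h : ℝ → ℝ) (J Q : ℝ → ℂ),
        0 ≤ κ →
        (∃ c : ℤ → ℂ, ∀ θ : ℝ, (h θ : ℂ) =
          ∑ k ∈ Finset.Icc (-(dh : ℤ)) dh, c k * Complex.exp ((k : ℂ) * (θ : ℂ) * Complex.I)) →
        (∀ θ, |h θ| ≤ κ) →
        (∃ c : ℤ → ℂ, ∀ θ : ℝ, J θ =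
          ∑ k ∈ Finset.Icc (-(dJ : ℤ)) dJ, c k * Complex.exp ((k : ℂ) * (θ : ℂ) * Complex.I)) →
        (∃ θ, J θ ≠ 0) →
        (∃ c : ℤ → ℂ, ∀ θ : ℝ, Q θ =
          ∑ k ∈ Finset.Icc (-(d : ℤ)) d, c k * Complex.exp ((k : ℂ) * (θ : ℂ) * Complex.I)) →
        let w : ℝ → ℝ := fun θ => Real.exp (h θ) * ‖J θ‖
        (∀ θ₀ : ℝ, ‖Q θ₀‖ ≤ C * (1 + κ) ^ p *
          ((∫ θ in (0 : ℝ)..(2 * Real.pi), ‖Q θ‖ * w θ) / (∫ θ in (0 : ℝ)..(2 * Real.pi), w θ))) ∧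
        (∀ s : ℝ, 0 < s → s ≤ s₀ →
          IntervalIntegrable (fun θ => ‖Q θ‖ ^ (-s) * w θ) MeasureTheory.volume 0 (2 * Real.pi) ∧
          (∫ θ in (0 : ℝ)..(2 * Real.pi), ‖Q θ‖ ^ (-s) * w θ) / (∫ θ in (0 : ℝ)..(2 * Real.pi), w θ) ≤
            C * (1 + κ) ^ p * (⨆ θ : ℝ, ‖Q θ‖) ^ (-s))) →
    ∀ n d : ℕ, ∃ s₀ C p : ℝ, 0 < s₀ ∧ 0 < C ∧
      ∀ (N : ℕ) [NeZero N] (R : Finset (Edge 4 N)), R.card ≤ n →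
      ∀ (U : GaugeConfig 4 N (Matrix.specialUnitaryGroup (Fin 3) ℂ)) (β : ℝ)
        (P Q : GaugeConfig 4 N (Matrix.specialUnitaryGroup (Fin 3) ℂ) → ℂ),
      (Continuous P ∧ ∀ (W : GaugeConfig 4 N (Matrix.specialUnitaryGroup (Fin 3) ℂ)) (e : Edge 4 N)
          (V B : Matrix.specialUnitaryGroup (Fin 3) ℂ) (T : ℝ → Matrix.specialUnitaryGroup (Fin 3) ℂ),
        (∀ θ : ℝ, ((T θ : Matrix.specialUnitaryGroup (Fin 3) ℂ) : Matrix (Fin 3) (Fin 3) ℂ) =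
          Matrix.diagonal ![Complex.exp (θ * Complex.I), Complex.exp (-(θ * Complex.I)), 1]) →
        ∃ c : ℤ → ℂ, ∀ θ : ℝ, P (Function.update W e (W e * (V * T θ * V⁻¹) * B)) =
          ∑ k ∈ Finset.Icc (-(d : ℤ)) d, c k * Complex.exp ((k : ℂ) * (θ : ℂ) * Complex.I)) →
      (Continuous Q ∧ ∀ (W : GaugeConfig 4 N (Matrix.specialUnitaryGroup (Fin 3) ℂ)) (e : Edge 4 N)
          (V B : Matrix.specialUnitaryGroup (Fin 3) ℂ) (T : ℝ → Matrix.specialUnitaryGroup (Fin 3) ℂ),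
        (∀ θ : ℝ, ((T θ : Matrix.specialUnitaryGroup (Fin 3) ℂ) : Matrix (Fin 3) (Fin 3) ℂ) =
          Matrix.diagonal ![Complex.exp (θ * Complex.I), Complex.exp (-(θ * Complex.I)), 1]) →
        ∃ c : ℤ → ℂ, ∀ θ : ℝ, Q (Function.update W e (W e * (V * T θ * V⁻¹) * B)) =
          ∑ k ∈ Finset.Icc (-(d : ℤ)) d, c k * Complex.exp ((k : ℂ) * (θ : ℂ) * Complex.I)) →
      let refit : GaugeConfig 4 N (Matrix.specialUnitaryGroup (Fin 3) ℂ) →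
          GaugeConfig 4 N (Matrix.specialUnitaryGroup (Fin 3) ℂ) := fun W e => if e ∈ R then W e else U e
      let wt : GaugeConfig 4 N (Matrix.specialUnitaryGroup (Fin 3) ℂ) → ℝ := fun W =>
        Real.exp (-(β * wilsonAction (fundamentalRep (Fin 3)) (refit W))) * ‖P (refit W)‖
      let haar : MeasureTheory.Measure (GaugeConfig 4 N (Matrix.specialUnitaryGroup (Fin 3) ℂ)) :=
        MeasureTheory.Measure.pi fun _ => haarProbability (Matrix.specialUnitaryGroup (Fin 3) ℂ)
      let Z : ℝ := ∫ W, wt W ∂haar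
      (∃ W, P (refit W) ≠ 0) →
        ((∃ W, Q (refit W) ≠ 0) → ∀ᵐ W ∂haar, Q (refit W) ≠ 0) ∧
        (∀ W₀ : GaugeConfig 4 N (Matrix.specialUnitaryGroup (Fin 3) ℂ),
          ‖Q (refit W₀)‖ ≤ C * (1 + |β|) ^ p * ((∫ W, ‖Q (refit W)‖ * wt W ∂haar) / Z)) ∧
        (∀ s : ℝ, 0 < s → s ≤ s₀ →
          MeasureTheory.Integrable (fun W => ‖Q (refit W)‖ ^ (-s) * wt W) haar ∧
          (∫ W, ‖Q (refit W)‖ ^ (-s) * wt W ∂haar) / Z ≤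
            C * (1 + |β|) ^ p * (⨆ W : GaugeConfig 4 N (Matrix.specialUnitaryGroup (Fin 3) ℂ), ‖Q (refit W)‖) ^ (-s)) :=
  fun _ => fibreBandLaw_let

end Summit.QuantumFields.QCD.Theorems.VonMisesCirclesC1
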